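import Summits.QuantumFields.YangMills.Theorems.SwapVirialDeficitZeroModeSigmaFourSmallBallHub
import HarnessLib

/-!
# Exact zero-mode rung Z5 — the σ-TWISTED FOUR-LEADER small ball, XI: the CAP RATE of the hub weight
# (measure-side crumb on the hub weight of part V; pays the BAD hubs of the flip decomposition; free-hands support of ⟨stmt-QuantumFields-24197⟩)

Part V showed that the hub weight `hubW a = (a₀²)^{−1/3}·(‖Im a‖²)^{−4/3}` is integrable on the unit ball of `ℍ` (AM–GM split into four
one-dimensional singular integrals `I(c) = ∫_{(−1,1)}(u²)^{−c}`).  Here the same split gives a RATE on the caps where the hub parameter `αβ`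
(`α = a₀/‖a‖`, `β = ‖Im a‖/‖a‖`) is small:
* §47 `singPow_le_cap`: on `{u² < η²}`, `(u²)^{−c} ≤ (η²)^δ·(u²)^{−(c+δ)}` — trading a power of `η` for a slightly worse (still integrable) exponent;
  `lintegral_prod_boxSing` (the product integral);
* §48 ★ `lintegral_ball_reCap_hubW_le`: `∫ 𝟙_{‖a‖<1, a₀² < η²}·hubW ≤ (η²)^{1/18}·3^{−4/3}·I(7/18)·I(4/9)³`; ★ `lintegral_ball_imCap_hubW_le`:
  `∫ 𝟙_{‖a‖<1, ‖Im a‖ < η}·hubW ≤ (η²)^{1/36}·3^{−4/3}·I(1/3)·I(17/36)·I(4/9)²` (all constants finite: `capConst_lt_top`);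
* §49 ★★ `lintegral_cone_cap_hubW_le`: for `0 < ε`, `∫_{ {|a₀|·‖Im a‖ < ε} } hubW dcone ≤ coneConst·((ε^{1/18} + ε^{1/36})·(…))`, and `abs_hub_mul_ge`:
  `|αβ| ≥ |a₀|·‖Im a‖` on the ball, so the cap `{|αβ| < ε}` of the flip decomposition is inside `{|a₀|·‖Im a‖ < ε}`.
HONEST LABEL: finite-dimensional measure theory (plan-level zero-mode rung of the DRAFT line «sharp-sigma»); no rate of the small-ball law is proved
here; NOT ⟨24197⟩; own crux ⟨22884⟩ OPEN (blocked-on ⟨19935⟩); the Yang–Mills mass gap is NOT proved; no summit is proved by a line.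
Width seat ym-line-sfw-p2-w3 g63 (cell ym-idea-1, free hands), `--supports stmt-QuantumFields-24197`.  THEOREMS ONLY, standard axioms, 0 `sorry`.
References: [cite: GonzalezarroyoAltes1988]; [cite: Vanbaal2001]; [cite: Luscher1983, §2]; [folklore].
-/

set_option autoImplicit false

noncomputable section

open MeasureTheory Quaternion Set
open scoped Quaternion ENNReal BigOperators
open Literature.MathematicalPhysics.QuantumLattice
open Literature.Analysis.Calculus (radialUnit radialUnit_def norm_radialUnit)
open Summit.QuantumFields.YangMills.Theorems.SwapTwistDeficit.ToronLog
open Summit.QuantumFields.YangMills.Theorems.ToronValleyVolume.NearlyCommutingCeiling (sq_norm_im_eq)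
open Summit.QuantumFields.YangMills.Theorems.SwapVirialDeficit.ZeroModeGroup

attribute [local instance] Literature.Analysis.FluidPDE.Tao2016.quatMeasurableSpace
  Literature.Analysis.FluidPDE.Tao2016.quatBorelSpace
  Literature.MathematicalPhysics.QuantumLattice.secondCountableTopology_su2

namespace Summit.QuantumFields.YangMills.Theorems.SwapVirialDeficit.ZeroModeSigma

/-! ## §47 Trading a power of the cap width for a worse exponent -/

/-- `(u²)^{−c} ≤ (η²)^δ·(u²)^{−(c+δ)}` for `u ≠ 0`, `u² < η²`, `δ ≥ 0`. [folklore] -/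
theorem rpow_neg_le_cap {u η c δ : ℝ} (hu : u ≠ 0) (huη : u ^ 2 < η ^ 2) (hδ : 0 ≤ δ) :
    (u ^ 2) ^ (-c) ≤ (η ^ 2) ^ δ * (u ^ 2) ^ (-(c + δ)) := by
  have hu2 : 0 < u ^ 2 := by positivity
  have e : (u ^ 2) ^ (-c) = (u ^ 2) ^ δ * (u ^ 2) ^ (-(c + δ)) := by
    rw [← Real.rpow_add hu2]; congr 1; ring
  rw [e]
  exact mul_le_mul_of_nonneg_right (Real.rpow_le_rpow hu2.le huη.le hδ) (Real.rpow_nonneg hu2.le _)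

/-- The same for `singPow` (value `⊤` at `u = 0` on both sides). [folklore] -/
theorem singPow_le_cap {u η : ℝ} (hη : 0 < η) (huη : u ^ 2 < η ^ 2) (c : ℝ) {δ : ℝ} (hδ : 0 ≤ δ) :
    singPow c u ≤ ENNReal.ofReal ((η ^ 2) ^ δ) * singPow (c + δ) u := by
  by_cases hu : u = 0
  · rw [hu, singPow_zero, singPow_zero, ENNReal.mul_top (ENNReal.ofReal_pos.2 (Real.rpow_pos_of_pos (by positivity) _)).ne']
  · rw [singPow_of_ne hu, singPow_of_ne hu, ← ENNReal.ofReal_mul (Real.rpow_nonneg (sq_nonneg _) _)]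
    exact ENNReal.ofReal_le_ofReal (rpow_neg_le_cap hu huη hδ)

/-- The product of four windowed singular powers integrates to the product of the `I(c)`'s. [folklore] -/
theorem lintegral_prod_boxSing (K : ℝ≥0∞) (c₀ c₁ c₂ c₃ : ℝ) :
    ∫⁻ p : ℝ × (ℝ × (ℝ × ℝ)), K * ({u : ℝ | u ^ 2 < 1}.indicator (singPow c₀) p.1 * ({u : ℝ | u ^ 2 < 1}.indicator (singPow c₁) p.2.1 *
      ({u : ℝ | u ^ 2 < 1}.indicator (singPow c₂) p.2.2.1 * {u : ℝ | u ^ 2 < 1}.indicator (singPow c₃) p.2.2.2))) =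
    K * (Ising c₀ * (Ising c₁ * (Ising c₂ * Ising c₃))) := by
  have hm3 : Measurable fun v : ℝ × ℝ => {u : ℝ | u ^ 2 < 1}.indicator (singPow c₂) v.1 * {u : ℝ | u ^ 2 < 1}.indicator (singPow c₃) v.2 :=
    ((measurable_boxSing _).comp measurable_fst).mul ((measurable_boxSing _).comp measurable_snd)
  have hm2 : Measurable fun u : ℝ × (ℝ × ℝ) => {u : ℝ | u ^ 2 < 1}.indicator (singPow c₁) u.1 *
      ({u : ℝ | u ^ 2 < 1}.indicator (singPow c₂) u.2.1 * {u : ℝ | u ^ 2 < 1}.indicator (singPow c₃) u.2.2) :=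
    ((measurable_boxSing _).comp measurable_fst).mul (hm3.comp measurable_snd)
  have hm1 : Measurable fun p : ℝ × (ℝ × (ℝ × ℝ)) => {u : ℝ | u ^ 2 < 1}.indicator (singPow c₀) p.1 *
      ({u : ℝ | u ^ 2 < 1}.indicator (singPow c₁) p.2.1 * ({u : ℝ | u ^ 2 < 1}.indicator (singPow c₂) p.2.2.1 *
        {u : ℝ | u ^ 2 < 1}.indicator (singPow c₃) p.2.2.2)) :=
    ((measurable_boxSing _).comp measurable_fst).mul (hm2.comp measurable_snd)
  rw [lintegral_const_mul _ hm1, lintegral_volume_prod_mul (measurable_boxSing _) hm2,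
    lintegral_volume_prod_mul (measurable_boxSing _) hm3, lintegral_volume_prod_mul (measurable_boxSing _) (measurable_boxSing _)]
  rfl

/-- `‖Im a‖ = √(a_I² + a_J² + a_K²)`. [folklore] -/
theorem norm_im_eq_sqrt (a : ℍ) : ‖a.im‖ = Real.sqrt (a.imI ^ 2 + a.imJ ^ 2 + a.imK ^ 2) := by
  have h : ‖a.im‖ ^ 2 = a.imI ^ 2 + a.imJ ^ 2 + a.imK ^ 2 := by rw [sq_norm_eq_sum_sq]; simp
  rw [← h, Real.sqrt_sq (norm_nonneg _)]

/-! ## §48 The two caps on the unit ball -/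

/-- ★ **The `a₀`-cap**: `∫ 𝟙_{‖a‖<1, a₀² < η²}·hubW ≤ (η²)^{1/18}·3^{−4/3}·I(7/18)·I(4/9)³` (`η > 0`). [folklore] -/
theorem lintegral_ball_reCap_hubW_le {η : ℝ} (hη : 0 < η) :
    ∫⁻ a : ℍ, (Metric.ball (0:ℍ) 1 ∩ {a : ℍ | a.re ^ 2 < η ^ 2}).indicator hubW a ≤
      ENNReal.ofReal ((η ^ 2) ^ (1/18 : ℝ) * (3:ℝ) ^ (-(4/3 : ℝ))) * (Ising (7/18) * (Ising (4/9) * (Ising (4/9) * Ising (4/9)))) := by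
  set B : Set (ℝ × (ℝ × (ℝ × ℝ))) := {p | p.1 ^ 2 + p.2.1 ^ 2 + p.2.2.1 ^ 2 + p.2.2.2 ^ 2 < 1 ∧ p.1 ^ 2 < η ^ 2} with hB
  set f : ℝ × (ℝ × (ℝ × ℝ)) → ℝ≥0∞ := fun p => B.indicator
      (fun p => singPow (1/3) p.1 * singPow (4/3) (Real.sqrt (p.2.1 ^ 2 + p.2.2.1 ^ 2 + p.2.2.2 ^ 2))) p with hf
  have hBm : MeasurableSet B := by
    rw [hB, Set.setOf_and]
    exact (measurableSet_lt (by fun_prop) measurable_const).inter (measurableSet_lt (by fun_prop) measurable_const)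
  have hfm : Measurable f :=
    (((measurable_singPow _).comp measurable_fst).mul ((measurable_singPow _).comp
      ((by fun_prop : Measurable fun p : ℝ × (ℝ × (ℝ × ℝ)) => p.2.1 ^ 2 + p.2.2.1 ^ 2 + p.2.2.2 ^ 2).sqrt))).indicator hBm
  have he : ∀ a : ℍ, (Metric.ball (0:ℍ) 1 ∩ {a : ℍ | a.re ^ 2 < η ^ 2}).indicator hubW a = f (coord4 a) := by
    intro a
    have hmem : a ∈ Metric.ball (0:ℍ) 1 ∩ {a : ℍ | a.re ^ 2 < η ^ 2} ↔ coord4 a ∈ B := by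
      show a ∈ Metric.ball (0:ℍ) 1 ∩ {a : ℍ | a.re ^ 2 < η ^ 2} ↔ a.re ^ 2 + a.imI ^ 2 + a.imJ ^ 2 + a.imK ^ 2 < 1 ∧ a.re ^ 2 < η ^ 2
      rw [mem_inter_iff, Metric.mem_ball, dist_zero_right, ← sq_norm_eq_sum_sq, pow_lt_one_iff_of_nonneg (norm_nonneg _) two_ne_zero]
      rfl
    simp only [hf]
    by_cases hm : a ∈ Metric.ball (0:ℍ) 1 ∩ {a : ℍ | a.re ^ 2 < η ^ 2}
    · rw [indicator_of_mem hm, indicator_of_mem (hmem.1 hm), hubW, norm_im_eq_sqrt]; rfl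
    · rw [indicator_of_notMem hm, indicator_of_notMem (fun h => hm (hmem.2 h))]
  rw [lintegral_congr he, measurePreserving_coord4.lintegral_comp hfm]
  have hKpos : 0 < (η ^ 2) ^ (1/18 : ℝ) * (3:ℝ) ^ (-(4/3 : ℝ)) := mul_pos (Real.rpow_pos_of_pos (by positivity) _) (Real.rpow_pos_of_pos (by norm_num) _)
  have hC : ENNReal.ofReal ((η ^ 2) ^ (1/18 : ℝ) * (3:ℝ) ^ (-(4/3 : ℝ))) ≠ 0 := (ENNReal.ofReal_pos.2 hKpos).ne'
  have hbd : ∀ p, f p ≤ ENNReal.ofReal ((η ^ 2) ^ (1/18 : ℝ) * (3:ℝ) ^ (-(4/3 : ℝ))) * ({u : ℝ | u ^ 2 < 1}.indicator (singPow (7/18)) p.1 *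
      ({u : ℝ | u ^ 2 < 1}.indicator (singPow (4/9)) p.2.1 * ({u : ℝ | u ^ 2 < 1}.indicator (singPow (4/9)) p.2.2.1 *
        {u : ℝ | u ^ 2 < 1}.indicator (singPow (4/9)) p.2.2.2))) := by
    intro p
    by_cases hm : p ∈ B
    swap
    · simp only [hf]; rw [indicator_of_notMem hm]; exact bot_le
    have hm' : p.1 ^ 2 + p.2.1 ^ 2 + p.2.2.1 ^ 2 + p.2.2.2 ^ 2 < 1 := hm.1
    have hcap : p.1 ^ 2 < η ^ 2 := hm.2
    have h0 : p.1 ∈ {u : ℝ | u ^ 2 < 1} := by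
      show p.1 ^ 2 < 1; nlinarith [sq_nonneg p.2.1, sq_nonneg p.2.2.1, sq_nonneg p.2.2.2]
    have h1 : p.2.1 ∈ {u : ℝ | u ^ 2 < 1} := by
      show p.2.1 ^ 2 < 1; nlinarith [sq_nonneg p.1, sq_nonneg p.2.2.1, sq_nonneg p.2.2.2]
    have h2 : p.2.2.1 ∈ {u : ℝ | u ^ 2 < 1} := by
      show p.2.2.1 ^ 2 < 1; nlinarith [sq_nonneg p.1, sq_nonneg p.2.1, sq_nonneg p.2.2.2]
    have h3 : p.2.2.2 ∈ {u : ℝ | u ^ 2 < 1} := by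
      show p.2.2.2 ^ 2 < 1; nlinarith [sq_nonneg p.1, sq_nonneg p.2.1, sq_nonneg p.2.2.1]
    simp only [hf]
    rw [indicator_of_mem hm, indicator_of_mem h0, indicator_of_mem h1, indicator_of_mem h2, indicator_of_mem h3]
    by_cases z0 : p.1 = 0
    · rw [z0, singPow_zero, singPow_zero, ENNReal.top_mul (mul_ne_zero (singPow_ne_zero _ _) (mul_ne_zero (singPow_ne_zero _ _) (singPow_ne_zero _ _))),
        ENNReal.mul_top hC]
      exact le_top
    by_cases z1 : p.2.1 = 0
    · rw [z1, singPow_zero, ENNReal.top_mul (mul_ne_zero (singPow_ne_zero _ _) (singPow_ne_zero _ _)), ENNReal.mul_top (singPow_ne_zero _ _),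
        ENNReal.mul_top hC]
      exact le_top
    by_cases z2 : p.2.2.1 = 0
    · rw [z2, singPow_zero, ENNReal.top_mul (singPow_ne_zero _ _), ENNReal.mul_top (singPow_ne_zero _ _), ENNReal.mul_top (singPow_ne_zero _ _),
        ENNReal.mul_top hC]
      exact le_top
    by_cases z3 : p.2.2.2 = 0
    · rw [z3, singPow_zero, ENNReal.mul_top (singPow_ne_zero _ _), ENNReal.mul_top (singPow_ne_zero _ _), ENNReal.mul_top (singPow_ne_zero _ _),
        ENNReal.mul_top hC]
      exact le_top
    have hS : 0 < p.2.1 ^ 2 + p.2.2.1 ^ 2 + p.2.2.2 ^ 2 := by positivity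
    have hsq : Real.sqrt (p.2.1 ^ 2 + p.2.2.1 ^ 2 + p.2.2.2 ^ 2) ≠ 0 := (Real.sqrt_pos.2 hS).ne'
    rw [singPow_of_ne z0, singPow_of_ne hsq, singPow_of_ne z0, singPow_of_ne z1, singPow_of_ne z2, singPow_of_ne z3, Real.sq_sqrt hS.le,
      ← ENNReal.ofReal_mul (Real.rpow_nonneg (sq_nonneg _) _), ← ENNReal.ofReal_mul (Real.rpow_nonneg (sq_nonneg _) _),
      ← ENNReal.ofReal_mul (Real.rpow_nonneg (sq_nonneg _) _), ← ENNReal.ofReal_mul (Real.rpow_nonneg (sq_nonneg _) _),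
      ← ENNReal.ofReal_mul hKpos.le]
    refine ENNReal.ofReal_le_ofReal ?_
    have hb := hub_bound z1 z2 z3
    have hc := rpow_neg_le_cap (c := 1/3) (δ := 1/18) z0 hcap (by norm_num)
    have e718 : -((1/3 : ℝ) + 1/18) = -(7/18 : ℝ) := by norm_num
    rw [e718] at hc
    calc (p.1 ^ 2) ^ (-(1/3 : ℝ)) * (p.2.1 ^ 2 + p.2.2.1 ^ 2 + p.2.2.2 ^ 2) ^ (-(4/3 : ℝ))
        ≤ ((η ^ 2) ^ (1/18 : ℝ) * (p.1 ^ 2) ^ (-(7/18 : ℝ))) *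
            ((3:ℝ) ^ (-(4/3 : ℝ)) * ((p.2.1 ^ 2) ^ (-(4/9 : ℝ)) * (p.2.2.1 ^ 2) ^ (-(4/9 : ℝ)) * (p.2.2.2 ^ 2) ^ (-(4/9 : ℝ)))) :=
          mul_le_mul hc hb (Real.rpow_nonneg hS.le _) (by positivity)
      _ = _ := by ring
  calc ∫⁻ p, f p ≤ _ := lintegral_mono hbd
    _ = _ := lintegral_prod_boxSing _ _ _ _ _

/-- ★ **The `Im`-cap**: `∫ 𝟙_{‖a‖<1, ‖Im a‖ < η}·hubW ≤ (η²)^{1/36}·3^{−4/3}·I(1/3)·I(17/36)·I(4/9)²` (`η > 0`). [folklore] -/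
theorem lintegral_ball_imCap_hubW_le {η : ℝ} (hη : 0 < η) :
    ∫⁻ a : ℍ, (Metric.ball (0:ℍ) 1 ∩ {a : ℍ | ‖a.im‖ < η}).indicator hubW a ≤
      ENNReal.ofReal ((η ^ 2) ^ (1/36 : ℝ) * (3:ℝ) ^ (-(4/3 : ℝ))) * (Ising (1/3) * (Ising (17/36) * (Ising (4/9) * Ising (4/9)))) := by
  set B : Set (ℝ × (ℝ × (ℝ × ℝ))) := {p | p.1 ^ 2 + p.2.1 ^ 2 + p.2.2.1 ^ 2 + p.2.2.2 ^ 2 < 1 ∧ p.2.1 ^ 2 + p.2.2.1 ^ 2 + p.2.2.2 ^ 2 < η ^ 2}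
    with hB
  set f : ℝ × (ℝ × (ℝ × ℝ)) → ℝ≥0∞ := fun p => B.indicator
      (fun p => singPow (1/3) p.1 * singPow (4/3) (Real.sqrt (p.2.1 ^ 2 + p.2.2.1 ^ 2 + p.2.2.2 ^ 2))) p with hf
  have hBm : MeasurableSet B := by
    rw [hB, Set.setOf_and]
    exact (measurableSet_lt (by fun_prop) measurable_const).inter (measurableSet_lt (by fun_prop) measurable_const)
  have hfm : Measurable f :=
    (((measurable_singPow _).comp measurable_fst).mul ((measurable_singPow _).comp
      ((by fun_prop : Measurable fun p : ℝ × (ℝ × (ℝ × ℝ)) => p.2.1 ^ 2 + p.2.2.1 ^ 2 + p.2.2.2 ^ 2).sqrt))).indicator hBm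
  have him2 : ∀ a : ℍ, ‖a.im‖ ^ 2 = a.imI ^ 2 + a.imJ ^ 2 + a.imK ^ 2 := by intro a; rw [sq_norm_eq_sum_sq]; simp
  have he : ∀ a : ℍ, (Metric.ball (0:ℍ) 1 ∩ {a : ℍ | ‖a.im‖ < η}).indicator hubW a = f (coord4 a) := by
    intro a
    have hmem : a ∈ Metric.ball (0:ℍ) 1 ∩ {a : ℍ | ‖a.im‖ < η} ↔ coord4 a ∈ B := by
      show a ∈ Metric.ball (0:ℍ) 1 ∩ {a : ℍ | ‖a.im‖ < η} ↔
        a.re ^ 2 + a.imI ^ 2 + a.imJ ^ 2 + a.imK ^ 2 < 1 ∧ a.imI ^ 2 + a.imJ ^ 2 + a.imK ^ 2 < η ^ 2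
      rw [mem_inter_iff, Metric.mem_ball, dist_zero_right, ← sq_norm_eq_sum_sq, pow_lt_one_iff_of_nonneg (norm_nonneg _) two_ne_zero, ← him2,
        mem_setOf_eq]
      have hn := norm_nonneg a.im
      constructor
      · rintro ⟨h1, h2⟩; exact ⟨h1, by nlinarith⟩
      · rintro ⟨h1, h2⟩; refine ⟨h1, ?_⟩; nlinarith
    simp only [hf]
    by_cases hm : a ∈ Metric.ball (0:ℍ) 1 ∩ {a : ℍ | ‖a.im‖ < η}
    · rw [indicator_of_mem hm, indicator_of_mem (hmem.1 hm), hubW, norm_im_eq_sqrt]; rfl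
    · rw [indicator_of_notMem hm, indicator_of_notMem (fun h => hm (hmem.2 h))]
  rw [lintegral_congr he, measurePreserving_coord4.lintegral_comp hfm]
  have hKpos : 0 < (η ^ 2) ^ (1/36 : ℝ) * (3:ℝ) ^ (-(4/3 : ℝ)) := mul_pos (Real.rpow_pos_of_pos (by positivity) _) (Real.rpow_pos_of_pos (by norm_num) _)
  have hC : ENNReal.ofReal ((η ^ 2) ^ (1/36 : ℝ) * (3:ℝ) ^ (-(4/3 : ℝ))) ≠ 0 := (ENNReal.ofReal_pos.2 hKpos).ne'
  have hbd : ∀ p, f p ≤ ENNReal.ofReal ((η ^ 2) ^ (1/36 : ℝ) * (3:ℝ) ^ (-(4/3 : ℝ))) * ({u : ℝ | u ^ 2 < 1}.indicator (singPow (1/3)) p.1 *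
      ({u : ℝ | u ^ 2 < 1}.indicator (singPow (17/36)) p.2.1 * ({u : ℝ | u ^ 2 < 1}.indicator (singPow (4/9)) p.2.2.1 *
        {u : ℝ | u ^ 2 < 1}.indicator (singPow (4/9)) p.2.2.2))) := by
    intro p
    by_cases hm : p ∈ B
    swap
    · simp only [hf]; rw [indicator_of_notMem hm]; exact bot_le
    have hm' : p.1 ^ 2 + p.2.1 ^ 2 + p.2.2.1 ^ 2 + p.2.2.2 ^ 2 < 1 := hm.1
    have hcap : p.2.1 ^ 2 < η ^ 2 := by nlinarith [hm.2, sq_nonneg p.2.2.1, sq_nonneg p.2.2.2]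
    have h0 : p.1 ∈ {u : ℝ | u ^ 2 < 1} := by
      show p.1 ^ 2 < 1; nlinarith [sq_nonneg p.2.1, sq_nonneg p.2.2.1, sq_nonneg p.2.2.2]
    have h1 : p.2.1 ∈ {u : ℝ | u ^ 2 < 1} := by
      show p.2.1 ^ 2 < 1; nlinarith [sq_nonneg p.1, sq_nonneg p.2.2.1, sq_nonneg p.2.2.2]
    have h2 : p.2.2.1 ∈ {u : ℝ | u ^ 2 < 1} := by
      show p.2.2.1 ^ 2 < 1; nlinarith [sq_nonneg p.1, sq_nonneg p.2.1, sq_nonneg p.2.2.2]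
    have h3 : p.2.2.2 ∈ {u : ℝ | u ^ 2 < 1} := by
      show p.2.2.2 ^ 2 < 1; nlinarith [sq_nonneg p.1, sq_nonneg p.2.1, sq_nonneg p.2.2.1]
    simp only [hf]
    rw [indicator_of_mem hm, indicator_of_mem h0, indicator_of_mem h1, indicator_of_mem h2, indicator_of_mem h3]
    by_cases z0 : p.1 = 0
    · rw [z0, singPow_zero, ENNReal.top_mul (mul_ne_zero (singPow_ne_zero _ _) (mul_ne_zero (singPow_ne_zero _ _) (singPow_ne_zero _ _))),
        ENNReal.mul_top hC]
      exact le_top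
    by_cases z1 : p.2.1 = 0
    · rw [z1, singPow_zero, ENNReal.top_mul (mul_ne_zero (singPow_ne_zero _ _) (singPow_ne_zero _ _)), ENNReal.mul_top (singPow_ne_zero _ _),
        ENNReal.mul_top hC]
      exact le_top
    by_cases z2 : p.2.2.1 = 0
    · rw [z2, singPow_zero, ENNReal.top_mul (singPow_ne_zero _ _), ENNReal.mul_top (singPow_ne_zero _ _), ENNReal.mul_top (singPow_ne_zero _ _),
        ENNReal.mul_top hC]
      exact le_top
    by_cases z3 : p.2.2.2 = 0
    · rw [z3, singPow_zero, ENNReal.mul_top (singPow_ne_zero _ _), ENNReal.mul_top (singPow_ne_zero _ _), ENNReal.mul_top (singPow_ne_zero _ _),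
        ENNReal.mul_top hC]
      exact le_top
    have hS : 0 < p.2.1 ^ 2 + p.2.2.1 ^ 2 + p.2.2.2 ^ 2 := by positivity
    have hsq : Real.sqrt (p.2.1 ^ 2 + p.2.2.1 ^ 2 + p.2.2.2 ^ 2) ≠ 0 := (Real.sqrt_pos.2 hS).ne'
    rw [singPow_of_ne z0, singPow_of_ne hsq, singPow_of_ne z1, singPow_of_ne z2, singPow_of_ne z3, Real.sq_sqrt hS.le,
      ← ENNReal.ofReal_mul (Real.rpow_nonneg (sq_nonneg _) _), ← ENNReal.ofReal_mul (Real.rpow_nonneg (sq_nonneg _) _),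
      ← ENNReal.ofReal_mul (Real.rpow_nonneg (sq_nonneg _) _), ← ENNReal.ofReal_mul (Real.rpow_nonneg (sq_nonneg _) _),
      ← ENNReal.ofReal_mul hKpos.le]
    refine ENNReal.ofReal_le_ofReal ?_
    have hb := hub_bound z1 z2 z3
    have hc := rpow_neg_le_cap (c := 4/9) (δ := 1/36) z1 hcap (by norm_num)
    have e1736 : -((4/9 : ℝ) + 1/36) = -(17/36 : ℝ) := by norm_num
    rw [e1736] at hc
    have h0' : 0 ≤ (p.1 ^ 2) ^ (-(1/3 : ℝ)) := Real.rpow_nonneg (sq_nonneg _) _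
    calc (p.1 ^ 2) ^ (-(1/3 : ℝ)) * (p.2.1 ^ 2 + p.2.2.1 ^ 2 + p.2.2.2 ^ 2) ^ (-(4/3 : ℝ))
        ≤ (p.1 ^ 2) ^ (-(1/3 : ℝ)) * ((3:ℝ) ^ (-(4/3 : ℝ)) * ((p.2.1 ^ 2) ^ (-(4/9 : ℝ)) * (p.2.2.1 ^ 2) ^ (-(4/9 : ℝ)) * (p.2.2.2 ^ 2) ^ (-(4/9 : ℝ)))) :=
          mul_le_mul_of_nonneg_left hb h0'
      _ ≤ (p.1 ^ 2) ^ (-(1/3 : ℝ)) * ((3:ℝ) ^ (-(4/3 : ℝ)) * (((η ^ 2) ^ (1/36 : ℝ) * (p.2.1 ^ 2) ^ (-(17/36 : ℝ))) *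
            (p.2.2.1 ^ 2) ^ (-(4/9 : ℝ)) * (p.2.2.2 ^ 2) ^ (-(4/9 : ℝ)))) := by
          gcongr
      _ = _ := by ring
  calc ∫⁻ p, f p ≤ _ := lintegral_mono hbd
    _ = _ := lintegral_prod_boxSing _ _ _ _ _

/-- All constants are finite. [folklore] -/
theorem capConst_lt_top :
    Ising (7/18) * (Ising (4/9) * (Ising (4/9) * Ising (4/9))) < ∞ ∧ Ising (1/3) * (Ising (17/36) * (Ising (4/9) * Ising (4/9))) < ∞ := by
  have h1 := Ising_lt_top (c := 7/18) (by norm_num) (by norm_num)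
  have h2 := Ising_lt_top (c := 4/9) (by norm_num) (by norm_num)
  have h3 := Ising_lt_top (c := 1/3) (by norm_num) (by norm_num)
  have h4 := Ising_lt_top (c := 17/36) (by norm_num) (by norm_num)
  exact ⟨ENNReal.mul_lt_top h1 (ENNReal.mul_lt_top h2 (ENNReal.mul_lt_top h2 h2)), ENNReal.mul_lt_top h3 (ENNReal.mul_lt_top h4 (ENNReal.mul_lt_top h2 h2))⟩

/-! ## §49 The cap of the cone measure -/

/-- On the unit ball the hub parameter dominates the raw product: `|α·β| ≥ |a₀|·‖Im a‖` (`α = a₀/‖a‖`, `β = ‖Im a‖/‖a‖`, `0 < ‖a‖ ≤ 1`). [folklore] -/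
theorem abs_re_mul_norm_im_le_hub {a : ℍ} (ha0 : a ≠ 0) (ha1 : ‖a‖ ≤ 1) :
    |a.re| * ‖a.im‖ ≤ |(radialUnit (axisPoint a)).re * (radialUnit (axisPoint a)).imI| := by
  obtain ⟨hre, hI, -, -⟩ := radialUnit_components (axisPoint a)
  have hc := axisPoint_components a
  rw [hre, hI, hc.1, hc.2.1, norm_axisPoint, abs_mul, abs_mul, abs_mul, abs_inv, abs_norm, abs_of_nonneg (norm_nonneg a.im)]
  have hn : 0 < ‖a‖ := norm_pos_iff.2 ha0
  have hinv : 1 ≤ ‖a‖⁻¹ := one_le_inv_iff₀.2 ⟨hn, ha1⟩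
  have h1 : |a.re| ≤ ‖a‖⁻¹ * |a.re| := le_mul_of_one_le_left (abs_nonneg _) hinv
  have h2 : ‖a.im‖ ≤ ‖a‖⁻¹ * ‖a.im‖ := le_mul_of_one_le_left (norm_nonneg _) hinv
  exact mul_le_mul h1 h2 (norm_nonneg _) (by positivity)

/-- The raw cap splits: `{|a₀|·‖Im a‖ < ε} ⊆ {a₀² < ε} ∪ {‖Im a‖ < √ε}` (`ε > 0`). [folklore] -/
theorem cap_subset_union {ε : ℝ} (hε : 0 < ε) :
    {a : ℍ | |a.re| * ‖a.im‖ < ε} ⊆ {a : ℍ | a.re ^ 2 < ε} ∪ {a : ℍ | ‖a.im‖ < Real.sqrt ε} := by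
  intro a ha
  simp only [mem_setOf_eq, mem_union] at ha ⊢
  by_contra h
  rw [not_or, not_lt, not_lt] at h
  have h1 : Real.sqrt ε ≤ |a.re| := by
    rw [← Real.sqrt_sq (abs_nonneg a.re), sq_abs]; exact Real.sqrt_le_sqrt h.1
  have : ε ≤ |a.re| * ‖a.im‖ := by
    calc ε = Real.sqrt ε * Real.sqrt ε := (Real.mul_self_sqrt hε.le).symm
      _ ≤ |a.re| * ‖a.im‖ := mul_le_mul h1 h.2 (Real.sqrt_nonneg _) (abs_nonneg _)
  linarith

/-- ★★ **THE CAP RATE OF THE HUB WEIGHT**: for `ε > 0`,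
`∫_{ {|a₀|·‖Im a‖ < ε} } hubW dcone ≤ coneConst·(ε^{1/18}·3^{−4/3}·I(7/18)I(4/9)³ + ε^{1/36}·3^{−4/3}·I(1/3)I(17/36)I(4/9)²)` — the bad hubs of the
flip decomposition cost a POWER of `ε`. [folklore] -/
theorem lintegral_cone_cap_hubW_le {ε : ℝ} (hε : 0 < ε) :
    ∫⁻ a in {a : ℍ | |a.re| * ‖a.im‖ < ε}, hubW a ∂coneMeasure ≤
      ENNReal.ofReal coneConst * (ENNReal.ofReal (ε ^ (1/18 : ℝ) * (3:ℝ) ^ (-(4/3 : ℝ))) * (Ising (7/18) * (Ising (4/9) * (Ising (4/9) * Ising (4/9)))) +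
        ENNReal.ofReal (ε ^ (1/36 : ℝ) * (3:ℝ) ^ (-(4/3 : ℝ))) * (Ising (1/3) * (Ising (17/36) * (Ising (4/9) * Ising (4/9))))) := by
  have hη : 0 < Real.sqrt ε := Real.sqrt_pos.2 hε
  have hS1 : MeasurableSet {a : ℍ | a.re ^ 2 < ε} := measurableSet_lt (by fun_prop) measurable_const
  have hS2 : MeasurableSet {a : ℍ | ‖a.im‖ < Real.sqrt ε} := measurableSet_lt (measurable_quat_im.norm) measurable_const
  have hcapm : MeasurableSet {a : ℍ | |a.re| * ‖a.im‖ < ε} :=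
    measurableSet_lt ((measurable_quat_re.abs).mul measurable_quat_im.norm) measurable_const
  -- monotonicity + union bound
  have h1 : ∫⁻ a in {a : ℍ | |a.re| * ‖a.im‖ < ε}, hubW a ∂coneMeasure ≤
      ∫⁻ a in {a : ℍ | a.re ^ 2 < ε}, hubW a ∂coneMeasure + ∫⁻ a in {a : ℍ | ‖a.im‖ < Real.sqrt ε}, hubW a ∂coneMeasure :=
    (lintegral_mono_set (cap_subset_union hε)).trans (lintegral_union_le _ _ _)
  refine h1.trans ?_
  -- each piece through the ball
  have piece : ∀ {S : Set ℍ}, MeasurableSet S →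
      ∫⁻ a in S, hubW a ∂coneMeasure = ENNReal.ofReal coneConst * ∫⁻ a, (Metric.ball (0:ℍ) 1 ∩ S).indicator hubW a := by
    intro S hS
    rw [← lintegral_indicator hS, lintegral_coneMeasure_eq, indicator_indicator]
  rw [piece hS1, piece hS2, ← mul_add]
  refine mul_le_mul_of_nonneg_left (add_le_add ?_ ?_) bot_le
  · have h := lintegral_ball_reCap_hubW_le hη
    rwa [Real.sq_sqrt hε.le] at h
  · have h := lintegral_ball_imCap_hubW_le hη
    have e : ((Real.sqrt ε) ^ 2) ^ (1/36 : ℝ) = ε ^ (1/36 : ℝ) := by rw [Real.sq_sqrt hε.le]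
    rwa [e] at h

end Summit.QuantumFields.YangMills.Theorems.SwapVirialDeficit.ZeroModeSigma

end
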